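import Mathlib
import HarnessLib
import Literature.Analysis.FluidPDE.SuitableWeak
import Literature.Analysis.FluidPDE.SelfSimilar
import Literature.Analysis.FluidPDE.LocalTypeI
import Literature.Analysis.FluidPDE.SpaceTimeRescaling
import Literature.Analysis.FluidPDE.LocalTypeIScaling
import Literature.Analysis.FluidPDE.LocalTypeICongr
import Literature.Analysis.FluidPDE.LocalTypeIReverseZoom
import Literature.Analysis.FluidPDE.SlabTypeICompactness
import Literature.Analysis.FluidPDE.TypeIRateOseenMildRepresentative
import Summits.NavierStokesRegularity.NavierStokesRegularity.Theorems.RellichScarApexLocalisationSpherePersistence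
import Summits.NavierStokesRegularity.NavierStokesRegularity.Theorems.RellichScarApexLocalisationSmallRateRegularity

/-!
# A singular point is a lump (line russian-doll-multiplicity of crux `RellichScar.ApexLocalisation`,
# stub `stub_rdSingularLump`)

QUANTITATIVE ACTIVITY BELOW A SINGULAR POINT.  For every `I < ⊤` there are `η, μ > 0` such that
every suitable weak solution `(w, q)` of Navier–Stokes on the backward slab `𝕊 = (-∞, 0) × ℝ³`
with weak gradient `H`, Albritton–Barker quantity `𝐈(w, q, H) ≤ I`, which is backward-singular at
the space–time origin, satisfies

  `|{z = (t, x) ∈ Q_1(0, 0) : η/√(−t) < ‖w(t, x)‖}| ≥ μ`,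

where `Q_1(0, 0) = (-1, 0) × B_1` is the unit backward parabolic cylinder (`stub_rdSingularLump`).

Proof (compactness + Borel–Cantelli + small-rate ε-regularity):

1. `η` is the small-rate regularity constant of `stub_smallRateRegularity` for the class `4 I`;
2. if no `μ > 0` works, pick for `μ_k = (1/2)^k` a violator `(w_k, q_k, H_k)`: class data `𝐈 ≤ I`,
   singular origin, and `|S_k| < (1/2)^k` for the superlevel set
   `S_k = {z ∈ Q_1(0,0) : η/√(−t) < ‖w_k(z)‖}`;
3. the ENGINE `slab_typeI_compactness` extracts `σ` and a limit `(u, p, H')` of class `4 I` with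
   `w_{σ j} → u` in `L³(Q(0, R))` for every `R > 0`; by persistence (every `w_{σ j}` is singular
   at the origin, so `‖w_{σ j}‖_{L^∞(Q(0,R))} = ∞`) the origin is a backward singular point of `u`;
4. along an a.e.-convergent subsequence `ns` on `Q_1(0,0)` (convergence in measure), Borel–Cantelli
   (`∑ |S_{σ (ns i)}| ≤ ∑ (1/2)^i < ∞`) shows that a.e. `z ∈ Q_1(0,0)` lies in only finitely many
   `S_{σ (ns i)}`, so `‖w_{σ (ns i)}(z)‖ ≤ η/√(−t)` eventually and hence `‖u(z)‖ ≤ η/√(−t)` a.e. on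
   `Q_1(0,0)`;
5. `stub_smallRateRegularity` now says `u` is NOT backward-singular at the origin — contradiction.

## References

* D. Albritton, T. Barker, *On local Type I singularities of the Navier–Stokes equations and
  Liouville theorems*, J. Math. Fluid Mech. 21 (2019) = arXiv:1811.00502, Lemma 2.2, Prop. 2.3,
  §3. [cite: AlbrittonBarker2019]
-/

noncomputable section

set_option linter.dupNamespace false

namespace Summit.NavierStokesRegularity.NavierStokesRegularity.Theorems.RellichScarApexLocalisation

open MeasureTheory Set Function Metric Filter Topology TopologicalSpace
open scoped ENNReal NNReal
open Literature.Analysis Literature.Analysis.FluidPDE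

local notation "E³" => EuclideanSpace ℝ (Fin 3)

/-- The open backward slab `(-∞, 0) × ℝ³` (time first). -/
local notation "𝕊" => Literature.Analysis.FluidPDE.slab (EuclideanSpace ℝ (Fin 3)) (Set.Iio (0 : ℝ)) isOpen_Iio

/-! ### A tool: a.e. bounds off summably small exceptional sets pass to `L³`-limits -/

/-- **Borel–Cantelli transfer of a pointwise bound to an `L³`-limit.** If `f k → g` in `L³(μ)`
and, for every `k`, the bound `‖f k x‖ ≤ B x` fails only on a set of measure `≤ (1/2)^k`, then
`‖g x‖ ≤ B x` for `μ`-a.e. `x`: along an a.e.-convergent subsequence `ns` (convergence in measure)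
the exceptional sets have summable measures (`(1/2)^(ns i) ≤ (1/2)^i`), so by Borel–Cantelli a.e.
`x` lies in only finitely many of them, and the bound passes to the pointwise limit. -/
theorem rdSingularLump_ae_le_of_tendsto_eLpNorm_three {α F : Type*} [MeasurableSpace α]
    [NormedAddCommGroup F] {μ : Measure α} {f : ℕ → α → F} {g : α → F} {B : α → ℝ}
    (hf : ∀ k, AEStronglyMeasurable (f k) μ) (hg : AEStronglyMeasurable g μ)
    (hB : ∀ k, μ {x | B x < ‖f k x‖} ≤ ENNReal.ofReal ((1 / 2 : ℝ) ^ k))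
    (h : Tendsto (fun k => eLpNorm (f k - g) 3 μ) atTop (𝓝 0)) :
    ∀ᵐ x ∂μ, ‖g x‖ ≤ B x := by
  have h3 : (3 : ℝ≥0∞) ≠ 0 := by norm_num
  have hm : TendstoInMeasure μ f atTop g :=
    tendstoInMeasure_of_tendsto_eLpNorm (p := 3) h3 hf hg h
  obtain ⟨ns, hns, hae⟩ := hm.exists_seq_tendsto_ae
  -- Borel–Cantelli along the subsequence `ns`
  have hid : ∀ i : ℕ, i ≤ ns i := fun i => hns.id_le i
  have hsum : ∑' i, μ {x | B x < ‖f (ns i) x‖} ≠ ∞ := by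
    have hle : ∑' i, μ {x | B x < ‖f (ns i) x‖} ≤ ∑' i : ℕ, ENNReal.ofReal ((1 / 2 : ℝ) ^ i) := by
      refine ENNReal.tsum_le_tsum fun i => (hB (ns i)).trans ?_
      exact ENNReal.ofReal_le_ofReal
        (pow_le_pow_of_le_one (by norm_num) (by norm_num) (hid i))
    have hsum2 : ∑' i : ℕ, ENNReal.ofReal ((1 / 2 : ℝ) ^ i) = ENNReal.ofReal 2 := by
      rw [← ENNReal.ofReal_tsum_of_nonneg (fun n => by positivity) summable_geometric_two,
        tsum_geometric_two]
    exact ne_top_of_le_ne_top (hsum2 ▸ ENNReal.ofReal_ne_top) hle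
  have hev : ∀ᵐ x ∂μ, ∀ᶠ i in atTop, x ∉ {x | B x < ‖f (ns i) x‖} :=
    ae_eventually_notMem hsum
  filter_upwards [hae, hev] with x hx hxev
  have hle : ∀ᶠ i in atTop, ‖f (ns i) x‖ ≤ B x :=
    hxev.mono fun i hi => not_lt.1 hi
  exact le_of_tendsto hx.norm hle

/-! ### The stub -/

/-- **S1 (stub_rdSingularLump), A SINGULAR POINT IS A LUMP.** For every `I < ⊤` there are
`η, μ > 0` such that every suitable weak slab solution with `𝐈 ≤ I` which is backward-singular at
the space–time origin has `|{z ∈ Q_1(0,0) : η/√(−t) < ‖w(z)‖}| ≥ μ`.  Here `η` is the small-rate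
regularity constant of `stub_smallRateRegularity` for the class `4 I`; if no `μ` works, violators
with exceptional measures `< (1/2)^k` have, by the ENGINE `slab_typeI_compactness` (persistence of
the singular origin) and Borel–Cantelli along an a.e.-convergent subsequence, an origin-singular
limit of class `4 I` with the small rate `η/√(−t)` a.e. on `Q_1(0,0)`, contradicting
`stub_smallRateRegularity`. [cite: AlbrittonBarker2019, Lemma 2.2, Prop. 2.3 and §3] -/
theorem stub_rdSingularLump :
    ∀ (I : ℝ≥0∞), I < ⊤ → ∃ η : ℝ, 0 < η ∧ ∃ μ : ℝ, 0 < μ ∧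
      ∀ (w : ℝ → E³ → E³) (q : ℝ → E³ → ℝ) (H : ℝ → E³ → E³ →L[ℝ] E³),
        IsSuitableWeakSolutionOn 𝕊 1 0 w q → HasWeakSpatialGradientOn 𝕊 w H →
        typeIBound (Iio (0 : ℝ) ×ˢ univ) w q H ≤ I → IsBackwardSingularPoint w 0 →
        ENNReal.ofReal μ ≤
          volume {z ∈ parabolicCylinder 1 (0 : ℝ × E³) | η / Real.sqrt (-z.1) < ‖w z.1 z.2‖} := by
  intro I hI
  -- ## Step 1: the small-rate regularity constant of the class `4 I`
  obtain ⟨η, hη, hreg⟩ :=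
    stub_smallRateRegularity (4 * I) (ENNReal.mul_lt_top (by simp) hI)
  refine ⟨η, hη, ?_⟩
  by_contra h
  push Not at h
  -- ## Step 2: violators for `μ_k = (1/2)^k`
  have hμ : ∀ k : ℕ, (0 : ℝ) < (1 / 2 : ℝ) ^ k := fun k => by positivity
  choose w q H hsw hwg hI' hsing hvol using fun k : ℕ => h ((1 / 2 : ℝ) ^ k) (hμ k)
  -- ## Step 3: the ENGINE and persistence of the singular origin
  obtain ⟨u, p, H', σ, hσ, hsw₀, hwg₀, hI₀, hconv, hpers⟩ :=
    slab_typeI_compactness I w q H hI hsw hwg hI'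
  have husing : IsBackwardSingularPoint u 0 := by
    refine hpers fun R hR => ?_
    have hconst : (fun j => eLpNorm (uncurry (w (σ j))) ⊤
        (volume.restrict (parabolicCylinder R (0 : ℝ × E³)))) = fun _ => (⊤ : ℝ≥0∞) :=
      funext fun j => hsing (σ j) R hR
    rw [hconst]
    exact limsup_const ⊤
  -- ## Step 4: Borel–Cantelli — the limit has the small rate a.e. on `Q_1(0,0)`
  have hQs : parabolicCylinder 1 (0 : ℝ × E³) ⊆ Iio (0 : ℝ) ×ˢ (univ : Set E³) :=
    parabolicCylinder_origin_subset_slab 1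
  have hQm : MeasurableSet (parabolicCylinder 1 (0 : ℝ × E³)) :=
    (isOpen_parabolicCylinder _ _).measurableSet
  have hum : ∀ j, AEStronglyMeasurable (uncurry (w (σ j)))
      (volume.restrict (parabolicCylinder 1 (0 : ℝ × E³))) := fun j =>
    ((hwg (σ j)).locallyIntegrableOn.aestronglyMeasurable).mono_measure
      (Measure.restrict_mono hQs le_rfl)
  have hvm : AEStronglyMeasurable (uncurry u)
      (volume.restrict (parabolicCylinder 1 (0 : ℝ × E³))) :=
    (hwg₀.locallyIntegrableOn.aestronglyMeasurable).mono_measure (Measure.restrict_mono hQs le_rfl)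
  have hB : ∀ j, volume.restrict (parabolicCylinder 1 (0 : ℝ × E³))
      {z | η / Real.sqrt (-z.1) < ‖uncurry (w (σ j)) z‖} ≤
      ENNReal.ofReal ((1 / 2 : ℝ) ^ j) := fun j => by
    rw [Measure.restrict_apply' hQm, setOf_inter_eq_sep]
    refine (hvol (σ j)).le.trans (ENNReal.ofReal_le_ofReal ?_)
    exact pow_le_pow_of_le_one (by norm_num) (by norm_num) (hσ.id_le j)
  have hsmall : ∀ᵐ z ∂(volume.restrict (parabolicCylinder 1 (0 : ℝ × E³))),
      ‖u z.1 z.2‖ ≤ η / Real.sqrt (-z.1) :=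
    rdSingularLump_ae_le_of_tendsto_eLpNorm_three hum hvm hB (hconv 1 one_pos)
  -- ## Step 5: contradiction with small-rate regularity
  exact hreg u p H' hsw₀ hwg₀ hI₀ hsmall husing

end Summit.NavierStokesRegularity.NavierStokesRegularity.Theorems.RellichScarApexLocalisation

end
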